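import Literature.AlgebraicGeometry.HodgeTheory.KodairaSerreSections
import Literature.AlgebraicGeometry.HodgeTheory.KodairaSerreFlagCount
import Literature.AlgebraicGeometry.HodgeTheory.TransverseFlagStraightening
import Literature.AlgebraicGeometry.Motives.CartierDivisorClassPullback
import Literature.Geometry.Kaehler.HolomorphicLineBundlePullback
import HarnessLib

/-!
# Kodaira–Serre sections in all dimensions by the count on the straightened atlas (second proof)

Layer `Literature/AlgebraicGeometry/HodgeTheory`. A second, independent proof of the content of the
named fact `kodairaSerre_exists_globalSection_algebraicTwist` (`KodairaSerreSections.lean`; C. Voisin,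
*Hodge Theory and Complex Algebraic Geometry I* (2002), proof of Cor. 11.34: "for sufficiently large
`N`, `L ⊗ H^{⊗N}` and `H^{⊗N}` admit non-zero holomorphic sections"; J.-P. Serre, *GAGA* (1956), n° 16
Lemme 8), whose discharge `kodairaSerre_exists_globalSection_algebraicTwist_holds` is the file
`KodairaSerreSectionsAllDim` (restriction sequences on the genuine submanifolds of the flag). Here the
count is Serre's over `n` general hyperplane sections (FAC n° 81; D. Mumford, *Abelian Varieties*
(1970), §16) on ONE framed cover of the ambient manifold, WITHOUT Théorème 3, Kodaira vanishing or
Serre duality, the flag being made LINEAR by re-charting: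

* `n ≥ 1`: the transverse flag `s₀ = 1, s₁, …, s_{n-1}` of sections of `𝒪_X(H)`
  (`exists_transverse_flag`) is straightened pointwise (`TransverseFlagStraightening`: at each point
  the vanishing prefix `u_0, …, u_{j-1}` becomes the first `j` coordinates of a holomorphic chart on
  which `u_j ≠ 0`); on the re-charted analytification `M' = (flagAtlas …).Carrier` (the same complex
  manifold, `AmbientHolAtlasUniv`; `φ ∘ val` is again an analytification,
  `isAnalytification_comp_val`, and `L` is read as `val^* L`) the nested Leray data of the
  Cartan–Serre finiteness theorem have chart-convex members in straightening charts, so the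
  regular-sequence and Nullstellensatz hypotheses of the flag tower of Čech complexes
  (`SerreTheoremAFlag.exists_globalSection`, file `KodairaSerreFlagCount`) are the linear-slice
  theorems (`TransverseFlag.exists_eq_sum_sectionCoord_mul_of_mul_eq`,
  `TransverseFlag.exists_eq_sum_sectionCoord_mul_of_forall_eq_zero`); the resulting non-zero section of
  `val^*(L ⊗ 𝒪_X(mH)^an)` is pulled back along the inverse `ofPoint` of `val`;
* `n = 0`: `X^an` is a finite non-empty set, the count runs with NO section (`N = 0`: the common zero
  set is everything, the skyscraper is `L` itself) on the original atlas, with `H = 0`.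

Main results: `exists_globalSection_twistBundle_of_transverse_flag` (`n ≥ 1`, for any transverse flag
with finite non-empty common zero set: some positive twist `L ⊗ 𝒪_X(mH)^an` has a section which is not
identically zero) and `exists_globalSection_twistBundle_of_dim_zero`; with `exists_transverse_flag` they
re-prove the named fact exactly as in `KodairaSerreSectionsAllDim` (assembly not repeated here).
Everything is proved; no new named fact.

## References

* C. Voisin, *Hodge Theory and Complex Algebraic Geometry I*, CUP (2002), Thm. 7.11 (proof),
  Cor. 11.34 (proof). [VoisinHodgeI2002]
* J.-P. Serre, *Géométrie algébrique et géométrie analytique*, Ann. Inst. Fourier 6 (1956), n° 16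
  Lemme 8. [SerreGAGA1956]
* J.-P. Serre, *Faisceaux algébriques cohérents*, Ann. of Math. 61 (1955), n° 81. [SerreFAC1955]
* D. Mumford, *Abelian Varieties* (1970), §16. [MumfordAV1970]
-/

noncomputable section

open scoped Manifold ContDiff Topology
open CategoryTheory AlgebraicGeometry TopologicalSpace Set Function
open Literature.AlgebraicGeometry.Motives
open Literature.AlgebraicGeometry.Motives.RatFn
open Literature.AlgebraicGeometry.Motives.AlgPoints
open Literature.NumberTheory.Transcendental
open Literature.Geometry.Kaehler
open Literature.Geometry.Kaehler.HolomorphicLineBundle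
open Literature.Algebra.Homology

namespace Literature.AlgebraicGeometry.HodgeTheory

/-! ### The re-charted analytification is an analytification -/

section Recharted

variable {X : SchemeOver ℂ} {n : ℕ}
  {E : Type} [NormedAddCommGroup E] [NormedSpace ℂ E] [FiniteDimensional ℂ E]
  {M : Type} [TopologicalSpace M] [ChartedSpace E M]
  {φ : M → ComplexPoints X}

/-- **`φ ∘ val` is an analytification of `X` on the re-charted manifold** (`val` is a
biholomorphism onto `M`: a homeomorphism along which regular functions stay holomorphic).
[cite: SerreGAGA1956, §2 n°6] -/
theorem isAnalytification_comp_val (hφ : IsAnalytification E X n φ) (𝒜 : AmbientHolAtlas E (univ : Set M) n) :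
    IsAnalytification (Fin n → ℂ) X n (φ ∘ 𝒜.val) where
  isHomeomorph := hφ.isHomeomorph.comp 𝒜.isHomeomorph_val
  finrank_eq := Module.finrank_fin_fun ℂ
  mdifferentiableOn_evalOrZero U t := (𝒜.mdifferentiableOn_comp_val_iff).2 (hφ.mdifferentiableOn_evalOrZero U t)

variable [IsIntegral X.left]

/-- `𝒪_X(D)^an` on the re-charted manifold is `val^*` of `𝒪_X(D)^an`, literally. [folklore] -/
theorem cartierDivisorLineBundle_comp_val (hφ : IsAnalytification E X n φ) (𝒜 : AmbientHolAtlas E (univ : Set M) n)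
    (D : CartierDivisor X.left) :
    cartierDivisorLineBundle (isAnalytification_comp_val hφ 𝒜) D =
      (cartierDivisorLineBundle hφ D).pullback 𝒜.val 𝒜.mdifferentiable_val :=
  rfl

/-- The tower `L ⊗ 𝒪_X(mH)^an` on the re-charted manifold is `val^*` of the tower, literally.
[folklore] -/
theorem twistBundle_comp_val (hφ : IsAnalytification E X n φ) (𝒜 : AmbientHolAtlas E (univ : Set M) n)
    (H : CartierDivisor X.left) {ι : Type} (L : HolomorphicLineBundle ι E M) (m : ℕ) :
    twistBundle (isAnalytification_comp_val hφ 𝒜) H (L.pullback 𝒜.val 𝒜.mdifferentiable_val) m =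
      (twistBundle hφ H L m).pullback 𝒜.val 𝒜.mdifferentiable_val :=
  rfl

omit [FiniteDimensional ℂ E] in
/-- `ofPoint^* (val^* L) = L`, literally (`val ∘ ofPoint = id`). [folklore] -/
theorem pullback_val_pullback_ofPoint (𝒜 : AmbientHolAtlas E (univ : Set M) n) {ι : Type}
    (L : HolomorphicLineBundle ι E M) :
    (L.pullback 𝒜.val 𝒜.mdifferentiable_val).pullback 𝒜.ofPoint 𝒜.mdifferentiable_ofPoint = L :=
  rfl

omit [FiniteDimensional ℂ E] in
/-- **A section of `val^* L` which is not identically zero gives one of `L`** (pull back along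
`ofPoint`). [folklore] -/
theorem exists_globalSection_of_comp_val (𝒜 : AmbientHolAtlas E (univ : Set M) n) {ι : Type}
    (L : HolomorphicLineBundle ι E M) (σ : (L.pullback 𝒜.val 𝒜.mdifferentiable_val).GlobalSection)
    (hσ : σ.zeroSet ≠ univ) : ∃ τ : L.GlobalSection, τ.zeroSet ≠ univ := by
  have h := GlobalSection.zeroSet_pullback_ne_univ σ 𝒜.ofPoint 𝒜.mdifferentiable_ofPoint
    𝒜.valHomeomorph.symm.surjective hσ
  exact ⟨σ.pullback 𝒜.ofPoint 𝒜.mdifferentiable_ofPoint, h⟩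

end Recharted

/-! ### Dimension `n ≥ 1`: the count on the straightened atlas -/

section PositiveDimension

variable {X : SchemeOver ℂ} [IsIntegral X.left] {n : ℕ}
  {E : Type} [NormedAddCommGroup E] [NormedSpace ℂ E] [FiniteDimensional ℂ E]
  {M : Type} [TopologicalSpace M] [ChartedSpace E M] [IsManifold 𝓘(ℂ, E) ω M]
  [T2Space M] [CompactSpace M]
  {φ : M → ComplexPoints X} (hφ : IsAnalytification E X n φ)
  (H : CartierDivisor X.left) {s : Fin n → X.left.functionField} (hs : ∀ j, H.IsSection (s j))
  (hflag : ∀ (a : H.ι) (m : M) (j : ℕ) (hj : j ≤ n), (φ m).pt ∈ H.U a →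
    (∀ i : Fin j, H.sectionCoord φ (hs (Fin.castLE hj i)) a m = 0) →
      Surjective (ContinuousLinearMap.pi fun i : Fin j ↦
        mfderiv 𝓘(ℂ, E) 𝓘(ℂ, ℂ) (H.sectionCoord φ (hs (Fin.castLE hj i)) a) m))
  {ι : Type} (L : HolomorphicLineBundle ι E M)

include hflag in
/-- **Serre's dimension count in dimension `n ≥ 1`**: on an analytification carrying a transverse flag
of `n` sections of `𝒪_X(H)` with finite non-empty common zero set, every
cocycle line bundle `L` has a positive twist `L ⊗ 𝒪_X(mH)^an` with a holomorphic section which is not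
identically zero (the count `SerreTheoremAFlag.exists_globalSection` on the re-charted analytification
`(flagAtlas …).Carrier`, pulled back along `ofPoint`). [cite: SerreGAGA1956, n°16 Lemme 8]
[cite: MumfordAV1970, §16] -/
theorem exists_globalSection_twistBundle_of_transverse_flag
    (hZfin : {m : M | ∃ a : H.ι, (φ m).pt ∈ H.U a ∧ ∀ j, H.sectionCoord φ (hs j) a m = 0}.Finite)
    (hZne : {m : M | ∃ a : H.ι, (φ m).pt ∈ H.U a ∧ ∀ j, H.sectionCoord φ (hs j) a m = 0}.Nonempty) :
    ∃ m, 0 < m ∧ ∃ σ : (twistBundle hφ H L m).GlobalSection, σ.zeroSet ≠ univ := by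
  classical
  -- the re-charted analytification
  set 𝒜 := TransverseFlag.flagAtlas hφ H hs hflag with h𝒜
  have hφ' : IsAnalytification (Fin n → ℂ) X n (φ ∘ 𝒜.val) := isAnalytification_comp_val hφ 𝒜
  set L' : HolomorphicLineBundle ι (Fin n → ℂ) 𝒜.Carrier := L.pullback 𝒜.val 𝒜.mdifferentiable_val with hL'
  -- nested Leray data subordinate to the tower on the re-charted manifold
  obtain ⟨D, fr, hfr, -⟩ := (twistBundle hφ' H L' 0).exists_dolbeaultLerayDatum_subordinate
    ⟨fun _ ↦ univ, fun _ ↦ isOpen_univ, fun _ ↦ mem_univ _⟩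
  -- the frame of a member and the member as a chart set
  have hfrm : ∀ {a : ℕ} {J : Fin (a + 1) → ↥D.s} {x : 𝒜.Carrier}, x ∈ cechSet (D.U 0) J →
      (φ (𝒜.val x)).pt ∈ H.U (fr (J 0)).2 := fun hx ↦
    SerreTheoremASurface.pt_mem_of_mem_cechSet hφ' H L' D fr hfr hx
  have hfrm' : ∀ (a : ℕ) (J : Fin (a + 1) → ↥D.s), ∀ x ∈ chartSet 𝓘(ℝ, Fin n → ℂ) (D.ctr a J) (D.C a J 0),
      (φ (𝒜.val x)).pt ∈ H.U (fr (J 0)).2 := fun a J x hx ↦ by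
    rw [← D.cechSet_eq a J 0] at hx
    exact hfrm hx
  -- the memberwise regular-sequence property
  have hreg : ∀ (i : Fin n) (a : ℕ) (J : Fin (a + 1) → ↥D.s) (f : holFunOn (Fin n → ℂ) (cechSet (D.U 0) J))
      (g : Fin n → holFunOn (Fin n → ℂ) (cechSet (D.U 0) J)),
      (∀ x ∈ cechSet (D.U 0) J, H.sectionCoord (φ ∘ 𝒜.val) (hs i) (fr (J 0)).2 x * (f : 𝒜.Carrier → ℂ) x =
        ∑ j ∈ (Finset.univ : Finset (Fin n)).filter (fun j : Fin n ↦ (j : ℕ) < (i : ℕ)),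
          H.sectionCoord (φ ∘ 𝒜.val) (hs j) (fr (J 0)).2 x * (g j : 𝒜.Carrier → ℂ) x) →
      ∃ h : Fin n → holFunOn (Fin n → ℂ) (cechSet (D.U 0) J), ∀ x ∈ cechSet (D.U 0) J,
        (f : 𝒜.Carrier → ℂ) x = ∑ j ∈ (Finset.univ : Finset (Fin n)).filter (fun j : Fin n ↦ (j : ℕ) < (i : ℕ)),
          H.sectionCoord (φ ∘ 𝒜.val) (hs j) (fr (J 0)).2 x * (h j : 𝒜.Carrier → ℂ) x := by
    intro i a J f g hfg
    have hfW : MDifferentiableOn 𝓘(ℂ, Fin n → ℂ) 𝓘(ℂ, ℂ) (f : 𝒜.Carrier → ℂ)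
        (chartSet 𝓘(ℝ, Fin n → ℂ) (D.ctr a J) (D.C a J 0)) := by
      rw [← D.cechSet_eq a J 0]; exact f.2.1
    have hgW : ∀ k, MDifferentiableOn 𝓘(ℂ, Fin n → ℂ) 𝓘(ℂ, ℂ) (g k : 𝒜.Carrier → ℂ)
        (chartSet 𝓘(ℝ, Fin n → ℂ) (D.ctr a J) (D.C a J 0)) := fun k ↦ by
      rw [← D.cechSet_eq a J 0]; exact (g k).2.1
    obtain ⟨h, hh, hfh⟩ := TransverseFlag.exists_eq_sum_sectionCoord_mul_of_mul_eq hφ H hs hflag (D.ctr a J)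
      (D.C_open a J 0) (D.C_convex a J 0) (D.C_subset a J 0) (hfrm' a J) i hfW hgW
      (fun x hx ↦ hfg x (by rw [D.cechSet_eq a J 0]; exact hx))
    rw [← D.cechSet_eq a J 0] at hh hfh
    exact ⟨fun k ↦ SerreTheoremASurface.holCut (h k) (hh k), fun x hx ↦ by
      rw [hfh x hx]
      exact Finset.sum_congr rfl fun k _ ↦ by
        beta_reduce
        rw [SerreTheoremASurface.holCut_apply_of_mem (h k) (hh k) hx]; rfl⟩
  -- the memberwise Nullstellensatz
  have hDv : ∀ (a : ℕ) (J : Fin (a + 1) → ↥D.s) (f : holFunOn (Fin n → ℂ) (cechSet (D.U 0) J)),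
      (∀ x ∈ SerreTheoremAFlag.zset (φ := φ ∘ 𝒜.val) H hs ∩ cechSet (D.U 0) J, (f : 𝒜.Carrier → ℂ) x = 0) →
        ∃ g : Fin n → holFunOn (Fin n → ℂ) (cechSet (D.U 0) J), ∀ x ∈ cechSet (D.U 0) J,
          (f : 𝒜.Carrier → ℂ) x = ∑ j, H.sectionCoord (φ ∘ 𝒜.val) (hs j) (fr (J 0)).2 x * (g j : 𝒜.Carrier → ℂ) x := by
    intro a J f hf
    have hfW : MDifferentiableOn 𝓘(ℂ, Fin n → ℂ) 𝓘(ℂ, ℂ) (f : 𝒜.Carrier → ℂ)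
        (chartSet 𝓘(ℝ, Fin n → ℂ) (D.ctr a J) (D.C a J 0)) := by
      rw [← D.cechSet_eq a J 0]; exact f.2.1
    obtain ⟨g, hg, hfg⟩ := TransverseFlag.exists_eq_sum_sectionCoord_mul_of_forall_eq_zero hφ H hs hflag
      (D.ctr a J) (D.C_open a J 0) (D.C_convex a J 0) (D.C_subset a J 0) (hfrm' a J) hfW
      (fun x hx h0 ↦ by
        rw [← D.cechSet_eq a J 0] at hx
        exact hf x ⟨(SerreTheoremAFlag.mem_zset_iff H hs (hfrm hx)).2 h0, hx⟩)
    rw [← D.cechSet_eq a J 0] at hg hfg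
    exact ⟨fun k ↦ SerreTheoremASurface.holCut (g k) (hg k), fun x hx ↦ by
      rw [hfg x hx]
      exact Finset.sum_congr rfl fun k _ ↦ by
        beta_reduce
        rw [SerreTheoremASurface.holCut_apply_of_mem (g k) (hg k) hx]; rfl⟩
  -- the common zero set, read on the re-charted manifold
  have hZ' : (SerreTheoremAFlag.zset (φ := φ ∘ 𝒜.val) H hs).Finite := by
    have h2 : (𝒜.val ⁻¹' {m : M | ∃ a : H.ι, (φ m).pt ∈ H.U a ∧ ∀ j, H.sectionCoord φ (hs j) a m = 0}).Finite :=
      hZfin.preimage 𝒜.val_injective.injOn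
    exact h2
  have hZne' : (SerreTheoremAFlag.zset (φ := φ ∘ 𝒜.val) H hs).Nonempty := by
    obtain ⟨z, hz⟩ := hZne
    exact ⟨𝒜.ofPoint z, hz⟩
  -- the count
  obtain ⟨m, hm0, σ', hσ'⟩ := SerreTheoremAFlag.exists_globalSection hφ' H L' hs D fr hfr hreg hDv hZ' hZne'
  refine ⟨m, hm0, ?_⟩
  have e : twistBundle hφ' H L' m = (twistBundle hφ H L m).pullback 𝒜.val 𝒜.mdifferentiable_val := rfl
  obtain ⟨σ'', hσ''⟩ : ∃ σ'' : ((twistBundle hφ H L m).pullback 𝒜.val 𝒜.mdifferentiable_val).GlobalSection,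
      σ''.zeroSet ≠ univ := by
    rw [← e]; exact ⟨σ', hσ'⟩
  exact exists_globalSection_of_comp_val 𝒜 _ σ'' hσ''

end PositiveDimension

/-! ### Dimension `0`: a finite set -/

section DimensionZero

variable {X : SchemeOver ℂ} [IsIntegral X.left]
  {E : Type} [NormedAddCommGroup E] [NormedSpace ℂ E] [FiniteDimensional ℂ E]
  {M : Type} [TopologicalSpace M] [ChartedSpace E M]
  {φ : M → ComplexPoints X} (hφ : IsAnalytification E X 0 φ)

include hφ in
omit [IsIntegral X.left] in
/-- An analytification of relative dimension `0` is a discrete space (its charts are valued in the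
zero space). [folklore] -/
theorem discreteTopology_of_isAnalytification_zero : DiscreteTopology M := by
  haveI : Subsingleton E := Module.finrank_zero_iff.1 hφ.finrank_eq
  rw [discreteTopology_iff_isOpen_singleton]
  intro x
  have hsub : (chartAt E x).source ⊆ {x} := fun y hy ↦ by
    have h := (chartAt E x).injOn hy (mem_chart_source E x) (Subsingleton.elim _ _)
    exact h
  have heq : (chartAt E x).source = {x} :=
    subset_antisymm hsub (singleton_subset_iff.2 (mem_chart_source E x))
  rw [← heq]
  exact (chartAt E x).open_source

/-- `1` is a section of the zero divisor. [folklore] -/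
theorem isSection_one_zero : (0 : CartierDivisor X.left).IsSection 1 := fun i x _ ↦ by
  rw [CartierDivisor.zero_f, one_mul]
  exact isRegularAt_one

variable [IsManifold 𝓘(ℂ, E) ω M] [IsManifold 𝓘(ℝ, E) ∞ M] [T2Space M] [CompactSpace M] [Nonempty M]

/-- **Dimension `0`**: every cocycle line bundle on a finite non-empty `0`-dimensional analytification
has a twist `L ⊗ 𝒪_X(m · 0)^an` with a section which is not identically zero (the count with no
section at all: the skyscraper complex of `L` at the whole space). [cite: SerreGAGA1956, n°16 Lemme 8] -/
theorem exists_globalSection_twistBundle_of_dim_zero {ι : Type} (L : HolomorphicLineBundle ι E M) :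
    ∃ m, 0 < m ∧ ∃ σ : (twistBundle hφ (0 : CartierDivisor X.left) L m).GlobalSection, σ.zeroSet ≠ univ := by
  classical
  haveI : DiscreteTopology M := discreteTopology_of_isAnalytification_zero hφ
  haveI : Finite M := finite_of_compact_of_discrete
  set H : CartierDivisor X.left := 0 with hH
  set s : Fin 0 → X.left.functionField := fun j ↦ Fin.elim0 j with hsdef
  have hs : ∀ j, H.IsSection (s j) := fun j ↦ Fin.elim0 j
  obtain ⟨D, fr, hfr, -⟩ := (twistBundle hφ H L 0).exists_dolbeaultLerayDatum_subordinate
    ⟨fun _ ↦ univ, fun _ ↦ isOpen_univ, fun _ ↦ mem_univ _⟩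
  have hzset : SerreTheoremAFlag.zset (φ := φ) H hs = univ := by
    refine eq_univ_of_forall fun x ↦ ?_
    exact ⟨(H.covers (φ x).pt).choose, (H.covers (φ x).pt).choose_spec, fun j ↦ Fin.elim0 j⟩
  have hreg : ∀ (i : Fin 0) (a : ℕ) (J : Fin (a + 1) → ↥D.s) (f : holFunOn E (cechSet (D.U 0) J))
      (g : Fin 0 → holFunOn E (cechSet (D.U 0) J)),
      (∀ x ∈ cechSet (D.U 0) J, H.sectionCoord φ (hs i) (fr (J 0)).2 x * (f : M → ℂ) x =
        ∑ j ∈ (Finset.univ : Finset (Fin 0)).filter (fun j : Fin 0 ↦ (j : ℕ) < (i : ℕ)),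
          H.sectionCoord φ (hs j) (fr (J 0)).2 x * (g j : M → ℂ) x) →
      ∃ h : Fin 0 → holFunOn E (cechSet (D.U 0) J), ∀ x ∈ cechSet (D.U 0) J,
        (f : M → ℂ) x = ∑ j ∈ (Finset.univ : Finset (Fin 0)).filter (fun j : Fin 0 ↦ (j : ℕ) < (i : ℕ)),
          H.sectionCoord φ (hs j) (fr (J 0)).2 x * (h j : M → ℂ) x := fun i ↦ Fin.elim0 i
  have hDv : ∀ (a : ℕ) (J : Fin (a + 1) → ↥D.s) (f : holFunOn E (cechSet (D.U 0) J)),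
      (∀ x ∈ SerreTheoremAFlag.zset (φ := φ) H hs ∩ cechSet (D.U 0) J, (f : M → ℂ) x = 0) →
        ∃ g : Fin 0 → holFunOn E (cechSet (D.U 0) J), ∀ x ∈ cechSet (D.U 0) J,
          (f : M → ℂ) x = ∑ j, H.sectionCoord φ (hs j) (fr (J 0)).2 x * (g j : M → ℂ) x := by
    intro a J f hf
    refine ⟨fun j ↦ Fin.elim0 j, fun x hx ↦ ?_⟩
    rw [Finset.univ_eq_empty, Finset.sum_empty]
    exact hf x ⟨by rw [hzset]; exact mem_univ x, hx⟩
  have hZ : (SerreTheoremAFlag.zset (φ := φ) H hs).Finite := by rw [hzset]; exact finite_univ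
  have hZne : (SerreTheoremAFlag.zset (φ := φ) H hs).Nonempty := by rw [hzset]; exact univ_nonempty
  exact SerreTheoremAFlag.exists_globalSection hφ H L hs D fr hfr hreg hDv hZ hZne

end DimensionZero

end Literature.AlgebraicGeometry.HodgeTheory

end
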